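import Mathlib
import Summits.CriticalPhenomena.CardyFormulaZ2.Theorems.CardyMagicRigidityNestingRigidityTransferRigidity
import Summits.CriticalPhenomena.CardyFormulaZ2.Theorems.CardyMagicRigidityNestingRigidityTransferSimpleLoops
import Literature.Probability.RandomPlanarGeometry.LoopConfigurations
import Literature.Probability.RandomPlanarGeometry.LoopWinding
import HarnessLib

/-!
# Stub `stub_treeRigidity`: reconstruction up to `d_CN` on an interior-rigid support class

Crux `Summit.CriticalPhenomena.CardyFormulaZ2.Theses.CardyMagicRigidity.NestingRigidity`
(stmt-CriticalPhenomena-4835), line `positive-cone-weight-doubling`, registered stub `stub_treeRigidity`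
(= `TreeRigidity` of `Theorems/CardyMagicRigidityPositiveConeDefs.lean`).  Step (2) of its route
(RECONSTRUCTION of a regular limit configuration from its nesting-tree statistics) is refuted AS A
PRINCIPLE under `Regular` alone (`exists_regular_patternCount_eq_not_isClose`, `…RegularNotRigid`,
p120899: the statistics see only the multiset of winding interiors, and across two configurations
`Regular` does not make `u ↦ {W(u, ·) ≠ 0}` injective up to time reversal).  This file proves,
sorry-free, the configuration-level form of step (2) under the MINIMAL extra support hypothesis, an
**interior-rigid class** `𝒞` of loops —

  `∀ u ∈ 𝒞, ∀ v ∈ 𝒞, {z | W(u, z) ≠ 0} = {z | W(v, z) ≠ 0} → d(u, v) = 0`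

(DKKMO's unoriented loop distance `UnbasedLoop.udist`; `d = 0` iff `v = u` or `v = u.reverse`,
`UnbasedLoop.udist_eq_zero_iff`) — written INLINE as a hypothesis (no new predicate):

* §1 `isClose_of_forall_exists_udist_eq_zero`, `cnEDist_eq_zero_of_forall_isClose` — a type-preserving
  correspondence of loops at `d`-distance `0` gives `d_CN ≤ ε` for every `ε ≥ 0`, hence `cnEDist = 0`.
* §2 `exists_interiorEquiv_udist_eq_zero_of_counts_eq` — two `Regular` configurations carried by an
  interior-rigid class, with the same one-disc and separated two-disc surround counts at rational data
  in every window (`patternCount`, `S = univ`, `n ≤ 2`: the hypotheses of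
  `exists_interiorEquiv_of_counts_eq`, p118827), have their loops in bijection `e` with
  `{W(e u) ≠ 0} = {W(u) ≠ 0}` AND `d(u, e u) = 0`; `isClose_untyped_of_counts_eq`,
  `cnEDist_untyped_eq_zero_of_counts_eq` (registered anchor) — hence the UNTYPED configurations
  (all loops filed under both types, `⟨fun _ ↦ c.loops⟩`) are at `d_CN`-distance `0`;
  `isClose_of_counts_eq_of_types` — and the TYPED ones too as soon as loops with equal interiors have
  equal types (the output of the type step (3) of the route, after the global type bit is fixed).
* §3 two sources of interior-rigid classes: `udist_eq_zero_of_windInjective` — a reversal-closed class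
  of SINGLE-SIGNED loops on which the winding FUNCTION is injective (`W(u, ·) = W(v, ·) → u = v`) is
  interior-rigid on its degree-one part (`W ∈ {0, ±1}`, `Regular.degreeOne`): this is the shape in which
  the conjectural rigidity of CLE₆-type loops (non-self-touching-from-both-sides "Carathéodory loops")
  will be supplied; and `udist_eq_zero_of_simpleLoop_of_interior_eq` — SIMPLE loops with the boundary
  property form an interior-rigid class NOW (`SimpleLoop.udist_eq_zero_of_range_eq`, p125567), whence
  `cnEDist_untyped_eq_zero_of_counts_eq_of_simpleLoops`: for regular configurations of simple loops the
  `n ≤ 2` surround counts determine the untyped configuration up to `d_CN = 0`.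

What remains for `stub_treeRigidity` after this file (see the audit `TreeRigidity-audit.md` of seat
c4-0): (a) the topological theorem that the natural CLE₆ support class is winding-injective; (b) the
law-level lift, which needs JOINT agreement of the count laws across disc families (single-family
agreement is insufficient: `…TreeRigidityFamilySwitch`); (c) the type bit.
-/

noncomputable section

open MeasureTheory Set Filter Metric
open scoped Real Topology BigOperators ENNReal

namespace Summit.CriticalPhenomena.CardyFormulaZ2.Cruxes.NestingRigidity.PositiveConeWeightDoubling

open Literature.Probability.RandomPlanarGeometry Literature.Probability.Percolation
  Literature.Probability.LatticeModels
open Summit.CriticalPhenomena.CardyFormulaZ2.Theses.CardyMagicRigidity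
open Summit.CriticalPhenomena.CardyFormulaZ2.Cruxes.NestingRigidity.RingCloudTomography

/-! ## §1 Closeness from a correspondence at loop distance `0` -/

/-- **A type-preserving correspondence at `d`-distance `0` gives `d_CN ≤ ε` for every `ε ≥ 0`.**
If every loop of either configuration has, among the loops of the same type of the other one, a loop
at DKKMO loop distance `d = 0` (i.e. itself or its time reversal), the two configurations are
`ε`-close in the printed sense for every `ε ≥ 0` (the window clause is not even needed). -/
theorem isClose_of_forall_exists_udist_eq_zero {ε : ℝ} (hε : 0 ≤ ε) {c c' : LoopConfig ℂ}
    (h : ∀ i, ∀ u ∈ c.F i, ∃ u' ∈ c'.F i, u.udist u' = 0)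
    (h' : ∀ i, ∀ u' ∈ c'.F i, ∃ u ∈ c.F i, u'.udist u = 0) : LoopConfig.IsClose ε c c' := by
  intro i
  refine ⟨fun u hu _ ↦ ?_, fun u' hu' _ ↦ ?_⟩
  · obtain ⟨u', hu', hd⟩ := h i u hu
    exact ⟨u', hu', hd.le.trans hε⟩
  · obtain ⟨u, hu, hd⟩ := h' i u' hu'
    exact ⟨u, hu, hd.le.trans hε⟩

/-- `d_CN ≤ ε` for every `ε > 0` means `cnEDist = 0`. -/
theorem cnEDist_eq_zero_of_forall_isClose {c c' : LoopConfig ℂ}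
    (h : ∀ ε : ℝ, 0 < ε → LoopConfig.IsClose ε c c') : LoopConfig.cnEDist c c' = 0 := by
  refine le_antisymm ?_ bot_le
  rw [← ENNReal.ofReal_zero]
  exact (LoopConfig.cnEDist_le_iff_forall_lt le_rfl).2 h

/-! ## §2 Reconstruction up to `d_CN = 0` on an interior-rigid class -/

/-- **Interior-preserving bijection at loop distance `0`.**  Let `𝒞` be an INTERIOR-RIGID class of
loops (`{W(u) ≠ 0} = {W(v) ≠ 0} → d(u, v) = 0` on `𝒞`) carrying two `Regular` configurations `c`, `c'`
with the same one-disc and separated two-disc surround counts at rational data in every window.  Then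
the loops of `c` and `c'` correspond under a bijection preserving winding interiors
(`exists_interiorEquiv_of_counts_eq`) whose pairs are at DKKMO loop distance `d = 0`. -/
theorem exists_interiorEquiv_udist_eq_zero_of_counts_eq {𝒞 : Set (UnbasedLoop ℂ)}
    (h𝒞 : ∀ u ∈ 𝒞, ∀ v ∈ 𝒞, {z | u.wind z ≠ 0} = {z | v.wind z ≠ 0} → u.udist v = 0)
    {c c' : LoopConfig ℂ} (hc : Regular c) (hc' : Regular c') (hsub : c.loops ⊆ 𝒞)
    (hsub' : c'.loops ⊆ 𝒞)
    (h₁ : ∀ (R : ℝ) (q : ℚ × ℚ) (s : ℚ), 0 < s →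
      patternCount c ![(⟨q.1, q.2⟩ : ℂ)] ![(s : ℝ)] R Finset.univ =
        patternCount c' ![(⟨q.1, q.2⟩ : ℂ)] ![(s : ℝ)] R Finset.univ)
    (h₂ : ∀ (R : ℝ) (q q' : ℚ × ℚ) (s s' : ℚ), 0 < s → 0 < s' →
      (s : ℝ) + s' < ‖(⟨q.1, q.2⟩ : ℂ) - ⟨q'.1, q'.2⟩‖ →
      patternCount c ![(⟨q.1, q.2⟩ : ℂ), ⟨q'.1, q'.2⟩] ![(s : ℝ), s'] R Finset.univ =
        patternCount c' ![(⟨q.1, q.2⟩ : ℂ), ⟨q'.1, q'.2⟩] ![(s : ℝ), s'] R Finset.univ) :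
    ∃ e : c.loops ≃ c'.loops, ∀ u : c.loops,
      {w | (e u : UnbasedLoop ℂ).wind w ≠ 0} = {w | (u : UnbasedLoop ℂ).wind w ≠ 0} ∧
        (u : UnbasedLoop ℂ).udist (e u) = 0 := by
  obtain ⟨e, he⟩ := exists_interiorEquiv_of_counts_eq hc hc' h₁ h₂
  exact ⟨e, fun u ↦ ⟨he u, h𝒞 _ (hsub u.2) _ (hsub' (e u).2) (he u).symm⟩⟩

/-- **Untyped closeness from the surround counts, on an interior-rigid class.**  Under the hypotheses
of `exists_interiorEquiv_udist_eq_zero_of_counts_eq`, the UNTYPED configurations (all loops of `c`,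
resp. `c'`, filed under both types) satisfy `d_CN ≤ ε` for every `ε ≥ 0`. -/
theorem isClose_untyped_of_counts_eq {𝒞 : Set (UnbasedLoop ℂ)}
    (h𝒞 : ∀ u ∈ 𝒞, ∀ v ∈ 𝒞, {z | u.wind z ≠ 0} = {z | v.wind z ≠ 0} → u.udist v = 0)
    {c c' : LoopConfig ℂ} (hc : Regular c) (hc' : Regular c') (hsub : c.loops ⊆ 𝒞)
    (hsub' : c'.loops ⊆ 𝒞)
    (h₁ : ∀ (R : ℝ) (q : ℚ × ℚ) (s : ℚ), 0 < s →
      patternCount c ![(⟨q.1, q.2⟩ : ℂ)] ![(s : ℝ)] R Finset.univ =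
        patternCount c' ![(⟨q.1, q.2⟩ : ℂ)] ![(s : ℝ)] R Finset.univ)
    (h₂ : ∀ (R : ℝ) (q q' : ℚ × ℚ) (s s' : ℚ), 0 < s → 0 < s' →
      (s : ℝ) + s' < ‖(⟨q.1, q.2⟩ : ℂ) - ⟨q'.1, q'.2⟩‖ →
      patternCount c ![(⟨q.1, q.2⟩ : ℂ), ⟨q'.1, q'.2⟩] ![(s : ℝ), s'] R Finset.univ =
        patternCount c' ![(⟨q.1, q.2⟩ : ℂ), ⟨q'.1, q'.2⟩] ![(s : ℝ), s'] R Finset.univ)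
    {ε : ℝ} (hε : 0 ≤ ε) :
    LoopConfig.IsClose ε (⟨fun _ ↦ c.loops⟩ : LoopConfig ℂ) ⟨fun _ ↦ c'.loops⟩ := by
  obtain ⟨e, he⟩ := exists_interiorEquiv_udist_eq_zero_of_counts_eq h𝒞 hc hc' hsub hsub' h₁ h₂
  refine isClose_of_forall_exists_udist_eq_zero hε (fun _ u hu ↦ ?_) (fun _ u' hu' ↦ ?_)
  · exact ⟨e ⟨u, hu⟩, (e ⟨u, hu⟩).2, (he ⟨u, hu⟩).2⟩
  · refine ⟨e.symm ⟨u', hu'⟩, (e.symm ⟨u', hu'⟩).2, ?_⟩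
    have := (he (e.symm ⟨u', hu'⟩)).2
    rw [Equiv.apply_symm_apply] at this
    rwa [UnbasedLoop.udist_comm]

/-- **Reconstruction up to `d_CN = 0` (registered anchor).**  Two `Regular` configurations all of whose
loops lie in an interior-rigid class `𝒞` (`{W(u) ≠ 0} = {W(v) ≠ 0} → d(u, v) = 0` on `𝒞`), with the
same one-disc and the same separated two-disc surround counts at rational centres and radii in every
window, have UNTYPED configurations at DKKMO distance `cnEDist = 0`.  (With `Regular` alone this is
false: `exists_regular_patternCount_eq_not_isClose`.) -/
theorem cnEDist_untyped_eq_zero_of_counts_eq : ∀ {𝒞 : Set (UnbasedLoop ℂ)},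
    (∀ u ∈ 𝒞, ∀ v ∈ 𝒞, {z | u.wind z ≠ 0} = {z | v.wind z ≠ 0} → u.udist v = 0) →
    ∀ {c c' : LoopConfig ℂ}, Regular c → Regular c' → c.loops ⊆ 𝒞 → c'.loops ⊆ 𝒞 →
    (∀ (R : ℝ) (q : ℚ × ℚ) (s : ℚ), 0 < s →
      patternCount c ![(⟨q.1, q.2⟩ : ℂ)] ![(s : ℝ)] R Finset.univ =
        patternCount c' ![(⟨q.1, q.2⟩ : ℂ)] ![(s : ℝ)] R Finset.univ) →
    (∀ (R : ℝ) (q q' : ℚ × ℚ) (s s' : ℚ), 0 < s → 0 < s' →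
      (s : ℝ) + s' < ‖(⟨q.1, q.2⟩ : ℂ) - ⟨q'.1, q'.2⟩‖ →
      patternCount c ![(⟨q.1, q.2⟩ : ℂ), ⟨q'.1, q'.2⟩] ![(s : ℝ), s'] R Finset.univ =
        patternCount c' ![(⟨q.1, q.2⟩ : ℂ), ⟨q'.1, q'.2⟩] ![(s : ℝ), s'] R Finset.univ) →
    LoopConfig.cnEDist (⟨fun _ ↦ c.loops⟩ : LoopConfig ℂ) ⟨fun _ ↦ c'.loops⟩ = 0 :=
  fun h𝒞 _ _ hc hc' hsub hsub' h₁ h₂ ↦ cnEDist_eq_zero_of_forall_isClose fun _ hε ↦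
    isClose_untyped_of_counts_eq h𝒞 hc hc' hsub hsub' h₁ h₂ hε.le

/-- **Typed closeness, given the type step.**  If moreover loops of `c` and `c'` with the same
winding interior have the same types (what step (3) of the route must deliver, after the one global
type bit has been matched), then the TYPED configurations satisfy `d_CN ≤ ε` for every `ε ≥ 0`, and
`cnEDist c c' = 0`. -/
theorem isClose_of_counts_eq_of_types {𝒞 : Set (UnbasedLoop ℂ)}
    (h𝒞 : ∀ u ∈ 𝒞, ∀ v ∈ 𝒞, {z | u.wind z ≠ 0} = {z | v.wind z ≠ 0} → u.udist v = 0)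
    {c c' : LoopConfig ℂ} (hc : Regular c) (hc' : Regular c') (hsub : c.loops ⊆ 𝒞)
    (hsub' : c'.loops ⊆ 𝒞)
    (h₁ : ∀ (R : ℝ) (q : ℚ × ℚ) (s : ℚ), 0 < s →
      patternCount c ![(⟨q.1, q.2⟩ : ℂ)] ![(s : ℝ)] R Finset.univ =
        patternCount c' ![(⟨q.1, q.2⟩ : ℂ)] ![(s : ℝ)] R Finset.univ)
    (h₂ : ∀ (R : ℝ) (q q' : ℚ × ℚ) (s s' : ℚ), 0 < s → 0 < s' →
      (s : ℝ) + s' < ‖(⟨q.1, q.2⟩ : ℂ) - ⟨q'.1, q'.2⟩‖ →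
      patternCount c ![(⟨q.1, q.2⟩ : ℂ), ⟨q'.1, q'.2⟩] ![(s : ℝ), s'] R Finset.univ =
        patternCount c' ![(⟨q.1, q.2⟩ : ℂ), ⟨q'.1, q'.2⟩] ![(s : ℝ), s'] R Finset.univ)
    (htype : ∀ u ∈ c.loops, ∀ u' ∈ c'.loops,
      {z | u.wind z ≠ 0} = {z | u'.wind z ≠ 0} → ∀ i, (u ∈ c.F i ↔ u' ∈ c'.F i)) :
    (∀ ε : ℝ, 0 ≤ ε → LoopConfig.IsClose ε c c') ∧ LoopConfig.cnEDist c c' = 0 := by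
  obtain ⟨e, he⟩ := exists_interiorEquiv_udist_eq_zero_of_counts_eq h𝒞 hc hc' hsub hsub' h₁ h₂
  have key : ∀ ε : ℝ, 0 ≤ ε → LoopConfig.IsClose ε c c' := by
    intro ε hε
    refine isClose_of_forall_exists_udist_eq_zero hε (fun i u hu ↦ ?_) (fun i u' hu' ↦ ?_)
    · have hul : u ∈ c.loops := LoopConfig.subset_loops c i hu
      refine ⟨e ⟨u, hul⟩, ?_, (he ⟨u, hul⟩).2⟩
      exact (htype u hul _ (e ⟨u, hul⟩).2 (he ⟨u, hul⟩).1.symm i).1 hu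
    · have hul' : u' ∈ c'.loops := LoopConfig.subset_loops c' i hu'
      have h1 := he (e.symm ⟨u', hul'⟩)
      rw [Equiv.apply_symm_apply] at h1
      refine ⟨e.symm ⟨u', hul'⟩, ?_, by rw [UnbasedLoop.udist_comm]; exact h1.2⟩
      exact (htype _ (e.symm ⟨u', hul'⟩).2 u' hul' h1.1.symm i).2 hu'
  exact ⟨key, cnEDist_eq_zero_of_forall_isClose fun ε hε ↦ key ε hε.le⟩

/-! ## §3 Interior-rigid classes: winding-injective single-signed classes; simple loops -/

/-- **Equal interiors, single signs and degree one give equal winding FUNCTIONS up to a global sign.**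
If `W(u, ·)`, `W(v, ·)` take values in `{0, ±1}`, each has a fixed sign, and `{W(u) ≠ 0} = {W(v) ≠ 0}`,
then `W(v, ·) = W(u, ·)` or `W(v, ·) = −W(u, ·)`. -/
theorem wind_eq_or_eq_neg_of_interior_eq {u v : UnbasedLoop ℂ}
    (hu1 : ∀ z, u.wind z = 0 ∨ u.wind z = 1 ∨ u.wind z = -1)
    (hv1 : ∀ z, v.wind z = 0 ∨ v.wind z = 1 ∨ v.wind z = -1)
    (hus : (∀ z, 0 ≤ u.wind z) ∨ (∀ z, u.wind z ≤ 0))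
    (hvs : (∀ z, 0 ≤ v.wind z) ∨ (∀ z, v.wind z ≤ 0))
    (h : {z | u.wind z ≠ 0} = {z | v.wind z ≠ 0}) :
    (∀ z, v.wind z = u.wind z) ∨ (∀ z, v.wind z = -u.wind z) := by
  have hiff : ∀ z, u.wind z ≠ 0 ↔ v.wind z ≠ 0 := fun z ↦ Set.ext_iff.1 h z
  rcases hus with hus | hus <;> rcases hvs with hvs | hvs
  · refine Or.inl fun z ↦ ?_
    have h1 := hu1 z; have h2 := hv1 z; have h3 := hus z; have h4 := hvs z; have h5 := hiff z
    omega
  · refine Or.inr fun z ↦ ?_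
    have h1 := hu1 z; have h2 := hv1 z; have h3 := hus z; have h4 := hvs z; have h5 := hiff z
    omega
  · refine Or.inr fun z ↦ ?_
    have h1 := hu1 z; have h2 := hv1 z; have h3 := hus z; have h4 := hvs z; have h5 := hiff z
    omega
  · refine Or.inl fun z ↦ ?_
    have h1 := hu1 z; have h2 := hv1 z; have h3 := hus z; have h4 := hvs z; have h5 := hiff z
    omega

/-- **Winding-injective single-signed classes are interior-rigid on their degree-one part.**  Let `𝒞`
be closed under time reversal, consist of single-signed loops (`W ≥ 0` everywhere or `W ≤ 0`
everywhere), and let the winding FUNCTION be injective on `𝒞` (`W(u, ·) = W(v, ·) → u = v`).  Then two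
loops of `𝒞` of covering degree one (`W ∈ {0, ±1}`, `Regular.degreeOne`) with the same winding
interior are at loop distance `d = 0`.  (The shape in which the rigidity of the CLE₆ support class is to
be supplied: single signs kill the figure-eight `C₋⁺C₊⁺`/`C₋⁺C₊⁻` witness, injectivity of `W` the
retraced-arc witness.) -/
theorem udist_eq_zero_of_windInjective {𝒞 : Set (UnbasedLoop ℂ)}
    (hinj : ∀ u ∈ 𝒞, ∀ v ∈ 𝒞, (∀ z, u.wind z = v.wind z) → u = v)
    (hrev : ∀ u ∈ 𝒞, u.reverse ∈ 𝒞)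
    (hsign : ∀ u ∈ 𝒞, (∀ z, 0 ≤ u.wind z) ∨ (∀ z, u.wind z ≤ 0))
    {u v : UnbasedLoop ℂ} (hu : u ∈ 𝒞) (hv : v ∈ 𝒞)
    (hu1 : ∀ z, u.wind z = 0 ∨ u.wind z = 1 ∨ u.wind z = -1)
    (hv1 : ∀ z, v.wind z = 0 ∨ v.wind z = 1 ∨ v.wind z = -1)
    (h : {z | u.wind z ≠ 0} = {z | v.wind z ≠ 0}) : u.udist v = 0 := by
  rw [UnbasedLoop.udist_eq_zero_iff]
  rcases wind_eq_or_eq_neg_of_interior_eq hu1 hv1 (hsign u hu) (hsign v hv) h with hw | hw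
  · exact Or.inl (hinj v hv u hu hw)
  · refine Or.inr (hinj v hv u.reverse (hrev u hu) fun z ↦ ?_)
    rw [UnbasedLoop.wind_reverse, hw z]

/-- **Simple loops with the boundary property are interior-rigid.**  Two unbased loops admitting
based representatives injective on `[0, 1)` whose traces are the frontiers of their winding interiors
and whose winding interiors coincide are at loop distance `d = 0`
(`SimpleLoop.udist_eq_zero_of_range_eq`, p125567). -/
theorem udist_eq_zero_of_simpleLoop_of_interior_eq {u v : UnbasedLoop ℂ}
    (hu : ∃ γ : {γ : Curve ℂ // γ.IsLoop}, InjOn γ.1 (Iio 1) ∧ Curve.unroot γ = u)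
    (hv : ∃ γ : {γ : Curve ℂ // γ.IsLoop}, InjOn γ.1 (Iio 1) ∧ Curve.unroot γ = v)
    (hbu : u.range = frontier {z | u.wind z ≠ 0}) (hbv : v.range = frontier {z | v.wind z ≠ 0})
    (h : {z | u.wind z ≠ 0} = {z | v.wind z ≠ 0}) : u.udist v = 0 :=
  SimpleLoop.udist_eq_zero_of_range_eq hu hv (by rw [hbu, hbv, h])

/-- **For regular configurations of SIMPLE loops the `n ≤ 2` surround counts determine the untyped
configuration up to `d_CN = 0`.**  Two `Regular` configurations all of whose loops admit based
representatives injective on `[0, 1)`, with the same one-disc and separated two-disc surround counts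
at rational data in every window, have untyped configurations at `cnEDist = 0`.  (Honest but too
strong for the lattice limits: CLE₆ loops touch themselves; the class to be used there is that of
`udist_eq_zero_of_windInjective`.) -/
theorem cnEDist_untyped_eq_zero_of_counts_eq_of_simpleLoops {c c' : LoopConfig ℂ} (hc : Regular c)
    (hc' : Regular c')
    (hsimple : ∀ u ∈ c.loops ∪ c'.loops,
      ∃ γ : {γ : Curve ℂ // γ.IsLoop}, InjOn γ.1 (Iio 1) ∧ Curve.unroot γ = u)
    (h₁ : ∀ (R : ℝ) (q : ℚ × ℚ) (s : ℚ), 0 < s →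
      patternCount c ![(⟨q.1, q.2⟩ : ℂ)] ![(s : ℝ)] R Finset.univ =
        patternCount c' ![(⟨q.1, q.2⟩ : ℂ)] ![(s : ℝ)] R Finset.univ)
    (h₂ : ∀ (R : ℝ) (q q' : ℚ × ℚ) (s s' : ℚ), 0 < s → 0 < s' →
      (s : ℝ) + s' < ‖(⟨q.1, q.2⟩ : ℂ) - ⟨q'.1, q'.2⟩‖ →
      patternCount c ![(⟨q.1, q.2⟩ : ℂ), ⟨q'.1, q'.2⟩] ![(s : ℝ), s'] R Finset.univ =
        patternCount c' ![(⟨q.1, q.2⟩ : ℂ), ⟨q'.1, q'.2⟩] ![(s : ℝ), s'] R Finset.univ) :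
    LoopConfig.cnEDist (⟨fun _ ↦ c.loops⟩ : LoopConfig ℂ) ⟨fun _ ↦ c'.loops⟩ = 0 := by
  -- the class: simple loops of `c` or `c'` (they all have the boundary property)
  refine cnEDist_untyped_eq_zero_of_counts_eq (𝒞 := c.loops ∪ c'.loops) (fun u hu v hv h ↦ ?_)
    hc hc' Set.subset_union_left Set.subset_union_right h₁ h₂
  have hb : ∀ w ∈ c.loops ∪ c'.loops, w.range = frontier {z | w.wind z ≠ 0} := by
    rintro w (hw | hw)
    exacts [hc.boundary w hw, hc'.boundary w hw]
  exact udist_eq_zero_of_simpleLoop_of_interior_eq (hsimple u hu) (hsimple v hv) (hb u hu) (hb v hv) h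

end Summit.CriticalPhenomena.CardyFormulaZ2.Cruxes.NestingRigidity.PositiveConeWeightDoubling

end
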